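import Mathlib
import Summits.CriticalPhenomena.PercolationContinuityZ3.Theorems.PercNearOneGluingNoHeavyLowerTailGoodUnitsGluing
import HarnessLib

/-!
# `NoHeavyLowerTail` (stmt-CriticalPhenomena-4575) — Kozma–Nitzan Conjecture 3 for SPIDERS, uniformly in the
# number of legs AND their length (connector legs allowed); the `G`-form via the observer bridge

Support file (depth prover `prim-nh-dp-blobmono` gen 7, 2026-08-19; `--supports stmt-CriticalPhenomena-4575`).
No definitions, no named facts, no sorries.  Answers the lead's model problem LEAD-GEN6 §8 / HANDOFF (Q7)
("SPIDERS uniform in `r` AND `L` with CONNECTOR legs — the smallest statement where the two solved axes meet").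

* `spider_gluing` — `o ∉ A`; every non-relay neighbour of `o` is the start of a LEG (an injective chain of
  non-relays avoiding `o` whose positive pairs towards non-relays go to chain neighbours; relay hairs arbitrary, so a
  leg vertex may connect several relays), distinct legs vertex-disjoint, `o` may also have relay neighbours, relay
  side arbitrary.  If `μ(a ↮ b off o) ≤ t` for all relays then for every `θ > 0`:
  `μ({o ↔ A} ∩ {o ↮ b}) ≤ θ + t/θ` (so `≤ 2√t`).  By `goodUnits_gluing` + `knGood_of_chain`.
* `bridge` — `μ(o ↮ b)·μ(a ↮ b off o) ≤ μ(a ↮ b)` (Harris for two decreasing events).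
* `goodUnits_nearOneGluing` — the `G`-form for every observer with good units (in particular every spider): if
  `μ(a ↮ b) ≤ t` for all relays IN `G`, then `μ(o ↮ b) ≤ μ(o ↮ A) + 2 t^{1/4}` — Conjecture 3 on the class with an
  explicit modulus, uniform in everything; `goodUnits_conjecture3` — the same in the `ε–δ` wording of `NearOneGluing`
  (`δ = min(ε/2, (ε/4)^4)`).
* `knGood_of_chain_tip` (+ `restrW_restrW`) — a chain whose TIP is any Kozma–Nitzan-good vertex (in the graph with the
  chain removed) is good: the socket through which future good-unit classes extend the spider theorem.
-/

namespace Summit.CriticalPhenomena.PercolationContinuityZ3.Theorems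

open MeasureTheory Set
open Literature.Probability.LatticeModels (prodBernoulli prodBernoulli_real_inter_of_determinedBy
  prodBernoulli_real_setOf_mem prodBernoulli_harris_upper_lower)
open Literature.Probability.Percolation

noncomputable section
open Classical

variable {n : ℕ}

namespace SpiderGluing

/-! ### 6. Spiders: legs (chains with relay hairs) are good units -/

/-- **SPIDER GLUING, `H`-form.**  `o ∉ A`, `b ∈ A`; every neighbour of `o` is in `X ∌ o`; every non-relay `x ∈ X` is
the start `p x 0 = x` of a LEG: an injective chain `p x : Fin (k x + 1) → Fin n` of non-relays avoiding `o` whose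
positive pairs towards non-relays other than `o` go to chain neighbours (relay hairs arbitrary — connector legs
allowed), distinct legs vertex-disjoint; relay side arbitrary.  If `μ(a ↮ b off o) ≤ t` for all relays then for every
`θ > 0`:  `μ({o ↔ A} ∩ {o ↮ b}) ≤ θ + t/θ` — uniformly in the number of legs AND their lengths. [this work] -/
theorem spider_gluing (w : Sym2 (Fin n) → unitInterval) (A X : Finset (Fin n)) (hA : A.Nonempty)
    (o b : Fin n) (hoA : o ∉ A) (hb : b ∈ A) (hoX : o ∉ X)
    (hX : ∀ y, y ≠ o → w s(o, y) ≠ 0 → y ∈ X)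
    (k : Fin n → ℕ) (p : ∀ x : Fin n, Fin (k x + 1) → Fin n)
    (hp0 : ∀ x ∈ X, x ∉ A → p x 0 = x) (hpinj : ∀ x ∈ X, x ∉ A → Function.Injective (p x))
    (hpA : ∀ x ∈ X, x ∉ A → ∀ i, p x i ∉ A) (hpo : ∀ x ∈ X, x ∉ A → ∀ i, p x i ≠ o)
    (hchain : ∀ x ∈ X, x ∉ A → ∀ (i : Fin (k x + 1)) (u : Fin n), u ∉ A → u ≠ p x i → u ≠ o →
      w s(p x i, u) ≠ 0 → ∃ l : Fin (k x + 1), u = p x l ∧ (l.val = i.val + 1 ∨ i.val = l.val + 1))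
    (hlegs : ∀ x ∈ X, ∀ x' ∈ X, x ≠ x' → x ∉ A → x' ∉ A → ∀ i j, p x i ≠ p x' j)
    (t : ℝ) (ht0 : 0 ≤ t)
    (ht : ∀ a ∈ A, (prodBernoulli w).real (openConnIn (({o} : Set (Fin n))ᶜ) a b)ᶜ ≤ t)
    (θ : ℝ) (hθ : 0 < θ) :
    (prodBernoulli w).real ((⋃ a ∈ A, (openConn o a : Set (BondConfig (Fin n)))) ∩ (openConn o b)ᶜ) ≤
      θ + t / θ := by
  -- the Steiner sets of the units
  set L : Fin n → Finset (Fin n) := fun x =>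
    if x ∈ A then ∅ else Finset.univ.filter (fun v => ∃ i, v = p x i) with hL
  have memL : ∀ x, x ∉ A → ∀ v, v ∈ L x ↔ ∃ i, v = p x i := by
    intro x hxA v
    simp [hL, hxA]
  have LA : ∀ x, x ∈ A → L x = ∅ := by
    intro x hxA
    simp [hL, hxA]
  refine goodUnits_gluing w A X hA o b hoA hb hoX hX L ?_ ?_ ?_ ?_ ?_ ?_ t ht0 ht θ hθ
  · -- `x ∈ L x`
    intro x hx hxA
    rw [memL x hxA]
    exact ⟨0, (hp0 x hx hxA).symm⟩
  · -- `o ∉ L x`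
    intro x hx hoLx
    by_cases hxA : x ∈ A
    · rw [LA x hxA] at hoLx; simp at hoLx
    · obtain ⟨i, hi⟩ := (memL x hxA o).1 hoLx
      exact hpo x hx hxA i hi.symm
  · -- `L x ∩ A = ∅`
    intro x hx
    by_cases hxA : x ∈ A
    · rw [LA x hxA]; exact Finset.disjoint_empty_left A
    · rw [Finset.disjoint_left]
      intro v hv hvA
      obtain ⟨i, rfl⟩ := (memL x hxA v).1 hv
      exact hpA x hx hxA i hvA
  · -- distinct legs are disjoint
    intro x hx x' hx' hxx'
    by_cases hxA : x ∈ A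
    · rw [LA x hxA]; exact Finset.disjoint_empty_left _
    by_cases hx'A : x' ∈ A
    · rw [LA x' hx'A]; exact Finset.disjoint_empty_right _
    rw [Finset.disjoint_left]
    intro v hv hv'
    obtain ⟨i, rfl⟩ := (memL x hxA v).1 hv
    obtain ⟨j, hj⟩ := (memL x' hx'A _).1 hv'
    exact hlegs x hx x' hx' hxx' hxA hx'A i j hj
  · -- closure of the legs
    intro x hx u hu v hvL hvA hvo
    by_cases hxA : x ∈ A
    · rw [LA x hxA] at hu; simp at hu
    · obtain ⟨i, rfl⟩ := (memL x hxA u).1 hu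
      by_contra hne
      by_cases hvu : v = p x i
      · exact hvL ((memL x hxA v).2 ⟨i, hvu⟩)
      · obtain ⟨l, rfl, _⟩ := hchain x hx hxA i v hvA hvu hvo hne
        exact hvL ((memL x hxA _).2 ⟨l, rfl⟩)
  · -- the legs are good in `G − o`
    intro x hx hxA
    set w' := restrW (({o} : Set (Fin n))ᶜ) w with hw'
    have key := knGood_of_chain A hA b hb (k x) w' (p x) (hpinj x hx hxA) (hpA x hx hxA) ?_
    · rw [hp0 x hx hxA] at key
      exact key
    · intro i u huA hui hw0
      have huo : u ≠ o := by
        rintro rfl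
        exact hw0 (restrW_apply_of_not_mem w fun h => (mk_mem_wireSet_iff.1 h).2.1 rfl)
      have hw0' : w s(p x i, u) ≠ 0 := fun h0 => hw0 (le_antisymm ((restrW_le _ w _).trans h0.le) bot_le)
      exact hchain x hx hxA i u huA hui huo hw0'

/-! ### 7. Back to `G`: the bridge through the hub inequality, and the square-root forms -/

/-- **Observer bridge** (Harris for two decreasing events): `μ(o ↮ b) · μ(a ↮ b off o) ≤ μ(a ↮ b)` for `a ≠ o`
(if `a ↔ b` then either the path avoids `o` or `o ↔ b`). [cite: KozmaNitzan2024, Lemma 5 (p. 13) first visit to 0; Harris 1960 for decreasing events; this work] -/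
theorem bridge (w : Sym2 (Fin n) → unitInterval) {o a : Fin n} (b : Fin n) (hao : a ≠ o) :
    (prodBernoulli w).real (openConn o b : Set (BondConfig (Fin n)))ᶜ *
        (prodBernoulli w).real (openConnIn (({o} : Set (Fin n))ᶜ) a b : Set (BondConfig (Fin n)))ᶜ ≤
      (prodBernoulli w).real (openConn a b : Set (BondConfig (Fin n)))ᶜ := by
  by_cases hbo : b = o
  · subst hbo
    have h0 : (prodBernoulli w).real (openConn b b : Set (BondConfig (Fin n)))ᶜ = 0 := by
      have : (openConn b b : Set (BondConfig (Fin n)))ᶜ = ∅ := by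
        ext ω
        simp only [mem_compl_iff, mem_empty_iff_false, iff_false, not_not]
        exact SimpleGraph.Reachable.refl b
      rw [this, measureReal_empty]
    rw [h0, zero_mul]
    exact measureReal_nonneg
  have hincl : (openConn o b : Set (BondConfig (Fin n)))ᶜ ∩ (openConnIn (({o} : Set (Fin n))ᶜ) a b)ᶜ ⊆
      (openConn a b : Set (BondConfig (Fin n)))ᶜ := by
    intro ω hω hab
    obtain ⟨q⟩ := (hab : (openGraph ω).Reachable a b)
    rcases (KNPreFKG.walk_decomp (ObserverUnionBound.mem_starEvent_self o ω) q hbo).1 hao with h | ⟨_, u', hu'B, hu'o, hu'b⟩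
    · exact hω.2 h
    · exact hω.1 (ObserverUnionBound.openConn_of_edge_of_openConnIn hu'o hu'B hu'b)
  have hlow1 : IsLowerSet ((openConn o b : Set (BondConfig (Fin n)))ᶜ) := (isUpperSet_openConn o b).compl
  have hlow2 : IsLowerSet ((openConnIn (({o} : Set (Fin n))ᶜ) a b : Set (BondConfig (Fin n)))ᶜ) :=
    (isUpperSet_openConnIn _ a b).compl
  exact (Literature.Probability.LatticeModels.prodBernoulli_harris_lower _ hlow1 hlow2 MeasurableSet.of_discrete
    MeasurableSet.of_discrete).trans (measureReal_mono hincl (measure_ne_top _ _))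

/-- **Good units glue, `G`-form (Kozma–Nitzan Conjecture 3 on the class).**  Under the structural hypotheses of
`goodUnits_gluing`, if every relay has `μ(a ↮ b) ≤ t` IN `G`, then `μ(o ↮ b) ≤ μ(o ↮ A) + 2·t^{1/4}`.
Proof: either `μ(o ↮ b) ≤ √t`, or by the bridge every relay has `μ(a ↮ b off o) ≤ √t` and `goodUnits_gluing` with
`θ = t^{1/4}` applies. [this work] -/
theorem goodUnits_nearOneGluing (w : Sym2 (Fin n) → unitInterval) (A X : Finset (Fin n)) (hA : A.Nonempty)
    (o b : Fin n) (hoA : o ∉ A) (hb : b ∈ A) (hoX : o ∉ X)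
    (hX : ∀ y, y ≠ o → w s(o, y) ≠ 0 → y ∈ X)
    (L : Fin n → Finset (Fin n)) (hxL : ∀ x ∈ X, x ∉ A → x ∈ L x) (hoL : ∀ x ∈ X, o ∉ L x)
    (hLA : ∀ x ∈ X, Disjoint (L x) A) (hLL : ∀ x ∈ X, ∀ x' ∈ X, x ≠ x' → Disjoint (L x) (L x'))
    (hclos : ∀ x ∈ X, ∀ u ∈ L x, ∀ v, v ∉ L x → v ∉ A → v ≠ o → w s(u, v) = 0)
    (hgood : ∀ x ∈ X, x ∉ A → KNGood (restrW (({o} : Set (Fin n))ᶜ) w) A hA x b)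
    (t : ℝ) (hrel : ∀ a ∈ A, (prodBernoulli w).real (openConn a b : Set (BondConfig (Fin n)))ᶜ ≤ t) :
    (prodBernoulli w).real (openConn o b : Set (BondConfig (Fin n)))ᶜ ≤
      (prodBernoulli w).real (⋃ a ∈ A, (openConn o a : Set (BondConfig (Fin n))))ᶜ +
        2 * Real.sqrt (Real.sqrt t) := by
  set μ := prodBernoulli w with hμ
  set q := μ.real (openConn o b : Set (BondConfig (Fin n)))ᶜ with hq
  set δ₀ := μ.real (⋃ a ∈ A, (openConn o a : Set (BondConfig (Fin n))))ᶜ with hδ₀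
  set s := Real.sqrt t with hs
  set r := Real.sqrt s with hr
  have ht0 : 0 ≤ t := measureReal_nonneg.trans (hrel b hb)
  have hs0 : 0 ≤ s := Real.sqrt_nonneg t
  have hr0 : 0 ≤ r := Real.sqrt_nonneg s
  have hss : s = r ^ 2 := (Real.sq_sqrt hs0).symm
  have htt : t = s ^ 2 := (Real.sq_sqrt ht0).symm
  have hq1 : q ≤ 1 := measureReal_le_one
  have hq0 : 0 ≤ q := measureReal_nonneg
  have hδ0 : 0 ≤ δ₀ := measureReal_nonneg
  -- decomposition `{o ↮ b} ⊆ {o ↮ A} ∪ ({o ↔ A} ∩ {o ↮ b})`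
  have hdec : q ≤ δ₀ + μ.real ((⋃ a ∈ A, (openConn o a : Set (BondConfig (Fin n)))) ∩ (openConn o b)ᶜ) := by
    calc q ≤ μ.real ((⋃ a ∈ A, (openConn o a : Set (BondConfig (Fin n))))ᶜ ∪
          ((⋃ a ∈ A, (openConn o a : Set (BondConfig (Fin n)))) ∩ (openConn o b)ᶜ)) :=
          measureReal_mono (fun ω hω => by
            by_cases h : ω ∈ ⋃ a ∈ A, (openConn o a : Set (BondConfig (Fin n)))
            · exact Or.inr ⟨h, hω⟩
            · exact Or.inl h) (measure_ne_top _ _)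
      _ ≤ _ := measureReal_union_le _ _
  by_cases hbig : 1 ≤ 2 * r
  · linarith
  have hr1 : r ≤ 1 := by linarith
  have hsr : s ≤ r := by rw [hss]; nlinarith
  by_cases hcase : q ≤ s
  · linarith
  push Not at hcase
  -- every relay is `s`-reliable off `o`
  have hoff : ∀ a ∈ A, μ.real (openConnIn (({o} : Set (Fin n))ᶜ) a b : Set (BondConfig (Fin n)))ᶜ ≤ s := by
    intro a ha
    have hao : a ≠ o := fun h => hoA (h ▸ ha)
    have hbr := bridge w b hao
    have hm0 : 0 ≤ μ.real (openConnIn (({o} : Set (Fin n))ᶜ) a b : Set (BondConfig (Fin n)))ᶜ :=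
      measureReal_nonneg
    by_contra hlt
    push Not at hlt
    have h1 : q * μ.real (openConnIn (({o} : Set (Fin n))ᶜ) a b : Set (BondConfig (Fin n)))ᶜ ≤ s ^ 2 :=
      hbr.trans (htt ▸ hrel a ha)
    nlinarith
  by_cases hr00 : r = 0
  · -- `t = 0`: the gluing defect vanishes
    have hs00 : s = 0 := by rw [hss, hr00]; ring
    have hE : μ.real ((⋃ a ∈ A, (openConn o a : Set (BondConfig (Fin n)))) ∩ (openConn o b)ᶜ) ≤ 0 := by
      refine le_of_forall_pos_le_add fun ε hε => ?_
      have := goodUnits_gluing w A X hA o b hoA hb hoX hX L hxL hoL hLA hLL hclos hgood s hs0 hoff ε hε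
      rw [hs00, zero_div, add_zero] at this
      linarith
    nlinarith
  · have hrpos : 0 < r := lt_of_le_of_ne hr0 (Ne.symm hr00)
    have hE := goodUnits_gluing w A X hA o b hoA hb hoX hX L hxL hoL hLA hLL hclos hgood s hs0 hoff r hrpos
    have : r + s / r = 2 * r := by
      rw [hss]; field_simp; ring
    rw [this] at hE
    linarith

/-- `√(√δ) ≤ c` when `δ ≤ c^4` and `0 ≤ c`. [folklore] -/
theorem sqrt_sqrt_le {δ c : ℝ} (hc : 0 ≤ c) (h : δ ≤ c ^ 4) : Real.sqrt (Real.sqrt δ) ≤ c := by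
  have h1 : Real.sqrt δ ≤ c ^ 2 := by
    rw [show c ^ 4 = (c ^ 2) ^ 2 by ring] at h
    exact Real.sqrt_le_sqrt h |>.trans (le_of_eq (Real.sqrt_sq (by positivity)))
  exact (Real.sqrt_le_sqrt h1).trans (le_of_eq (Real.sqrt_sq hc))

/-- **Kozma–Nitzan Conjecture 3 holds on the good-units class, in `ε–δ` form**: with `δ := min(ε/2, (ε/4)^4)`, if
`μ(o ↔ A) > 1 − δ` and `μ(a ↔ b) > 1 − δ` for every relay, then `μ(o ↔ b) > 1 − ε` — for every observer whose units are
good in `G − o` (in particular every SPIDER, by `knGood_of_chain`), uniformly in everything else. [this work] -/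
theorem goodUnits_conjecture3 (ε : ℝ) (hε : 0 < ε) :
    ∃ δ : ℝ, 0 < δ ∧ ∀ (w : Sym2 (Fin n) → unitInterval) (A X : Finset (Fin n)) (hA : A.Nonempty) (o b : Fin n),
      o ∉ A → b ∈ A → o ∉ X → (∀ y, y ≠ o → w s(o, y) ≠ 0 → y ∈ X) →
      ∀ L : Fin n → Finset (Fin n), (∀ x ∈ X, x ∉ A → x ∈ L x) → (∀ x ∈ X, o ∉ L x) →
      (∀ x ∈ X, Disjoint (L x) A) → (∀ x ∈ X, ∀ x' ∈ X, x ≠ x' → Disjoint (L x) (L x')) →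
      (∀ x ∈ X, ∀ u ∈ L x, ∀ v, v ∉ L x → v ∉ A → v ≠ o → w s(u, v) = 0) →
      (∀ x ∈ X, x ∉ A → KNGood (restrW (({o} : Set (Fin n))ᶜ) w) A hA x b) →
      1 - δ < (prodBernoulli w).real (⋃ a ∈ A, (openConn o a : Set (BondConfig (Fin n)))) →
      (∀ a ∈ A, 1 - δ < (prodBernoulli w).real (openConn a b : Set (BondConfig (Fin n)))) →
      1 - ε < (prodBernoulli w).real (openConn o b : Set (BondConfig (Fin n))) := by
  refine ⟨min (ε / 2) ((ε / 4) ^ 4), lt_min (by linarith) (by positivity), ?_⟩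
  intro w A X hA o b hoA hb hoX hX L hxL hoL hLA hLL hclos hgood hoA' hrel'
  set μ := prodBernoulli w with hμ
  set δ := min (ε / 2) ((ε / 4) ^ 4) with hδ
  have hδ1 : δ ≤ ε / 2 := min_le_left _ _
  have hδ2 : δ ≤ (ε / 4) ^ 4 := min_le_right _ _
  have hc : ∀ S : Set (BondConfig (Fin n)), μ.real Sᶜ = 1 - μ.real S := fun S => by
    rw [measureReal_compl MeasurableSet.of_discrete, probReal_univ]
  have hrel : ∀ a ∈ A, μ.real (openConn a b : Set (BondConfig (Fin n)))ᶜ ≤ δ := by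
    intro a ha; rw [hc]; linarith [hrel' a ha]
  have key := goodUnits_nearOneGluing w A X hA o b hoA hb hoX hX L hxL hoL hLA hLL hclos hgood δ hrel
  rw [hc, hc] at key
  have h4 : Real.sqrt (Real.sqrt δ) ≤ ε / 4 := sqrt_sqrt_le (by linarith) hδ2
  linarith

/-! ### 8. Chains with an arbitrary good tip (for future good-unit classes) -/

/-- Restrictions compose: `restrW S (restrW T w) = restrW (S ∩ T) w`. [folklore] -/
theorem restrW_restrW {V : Type*} (S T : Set V) (w : Sym2 V → unitInterval) :
    restrW S (restrW T w) = restrW (S ∩ T) w := by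
  funext e
  by_cases hS : e ∈ wireSet S
  · by_cases hT : e ∈ wireSet T
    · have hST : e ∈ wireSet (S ∩ T) := ⟨fun x hx => ⟨hS.1 x hx, hT.1 x hx⟩, hS.2⟩
      rw [restrW_apply_of_mem _ hS, restrW_apply_of_mem _ hT, restrW_apply_of_mem _ hST]
    · have hST : e ∉ wireSet (S ∩ T) := fun h => hT ⟨fun x hx => (h.1 x hx).2, h.2⟩
      rw [restrW_apply_of_mem _ hS, restrW_apply_of_not_mem _ hT, restrW_apply_of_not_mem _ hST]
  · have hST : e ∉ wireSet (S ∩ T) := fun h => hS ⟨fun x hx => (h.1 x hx).1, h.2⟩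
    rw [restrW_apply_of_not_mem _ hS, restrW_apply_of_not_mem _ hST]

/-- **A chain with a good tip is good.**  If `p : Fin (k+2) → V` is injective, avoids `A`, satisfies the chain condition at
the vertices `p 0, …, p k` (positive pairs towards non-relays go to chain neighbours), and the TIP `p (k+1)` is
Kozma–Nitzan-good in `G ∖ {p 0, …, p k}`, then `(G, A, p 0, b)` is good.  (KN Thm 5 iterated; `knGood_of_chain` is the
case of a one-layer tip.  Any future goodness result for a unit class thus extends to "chain + that unit at the tip", and
then through `goodUnits_gluing` to observers with such legs.) [cite: KozmaNitzan2024, Thm 5 (p. 13); this work] -/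
theorem knGood_of_chain_tip {V : Type*} [Fintype V] [DecidableEq V] (A : Finset V) (hA : A.Nonempty) (b : V)
    (hb : b ∈ A) :
    ∀ (k : ℕ) (w : Sym2 V → unitInterval) (p : Fin (k + 2) → V), Function.Injective p → (∀ i, p i ∉ A) →
      (∀ (i : Fin (k + 2)) (u : V), i.val ≤ k → u ∉ A → u ≠ p i → w s(p i, u) ≠ 0 →
        ∃ l : Fin (k + 2), u = p l ∧ (l.val = i.val + 1 ∨ i.val = l.val + 1)) →
      KNGood (restrW ({v | ∃ i : Fin (k + 2), i.val ≤ k ∧ v = p i}ᶜ : Set V) w) A hA (p (Fin.last (k + 1))) b →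
      KNGood w A hA (p 0) b := by
  intro k
  induction k with
  | zero =>
    intro w p hpinj hpA hchain htip
    have hb0 : b ≠ p 0 := fun h => hpA 0 (h ▸ hb)
    have h10 : p 1 ≠ p 0 := fun h => by
      have := hpinj h
      exact absurd (congrArg Fin.val this) (by simp)
    refine KozmaNitzan2024_thm5 w A hA (p 0) b (p 1) (hpA 0) hb0 h10 ?_ ?_
    · intro u hu0 huA hu1
      by_contra hne
      obtain ⟨l, rfl, hl⟩ := hchain 0 u (le_refl _) huA hu0 hne
      rcases hl with hl | hl
      · apply hu1
        congr 1
        exact Fin.ext (by simpa using hl)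
      · simp at hl
    · have hset : ({v | ∃ i : Fin (0 + 2), i.val ≤ 0 ∧ v = p i}ᶜ : Set V) = ({p 0}ᶜ : Set V) := by
        ext v
        simp only [mem_compl_iff, mem_setOf_eq, mem_singleton_iff, not_iff_not]
        constructor
        · rintro ⟨i, hi, rfl⟩
          have : i = 0 := Fin.ext (by rw [Fin.val_zero]; omega)
          rw [this]
        · rintro rfl
          exact ⟨0, le_refl _, rfl⟩
      have hlast : (Fin.last (0 + 1) : Fin (0 + 2)) = 1 := rfl
      rw [hset, hlast] at htip
      exact htip
  | succ k ih =>
    intro w p hpinj hpA hchain htip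
    have hb0 : b ≠ p 0 := fun h => hpA 0 (h ▸ hb)
    have h10 : p 1 ≠ p 0 := fun h => by
      have := hpinj h
      exact absurd (congrArg Fin.val this) (by simp)
    refine KozmaNitzan2024_thm5 w A hA (p 0) b (p 1) (hpA 0) hb0 h10 ?_ ?_
    · intro u hu0 huA hu1
      by_contra hne
      obtain ⟨l, rfl, hl⟩ := hchain 0 u (Nat.zero_le _) huA hu0 hne
      rcases hl with hl | hl
      · apply hu1
        congr 1
        exact Fin.ext (by simpa using hl)
      · simp at hl
    · -- the tail `p 1, …, p (k+2)` is a chain with a good tip in `G ∖ {p 0}`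
      set w' := restrW ({p 0}ᶜ : Set V) w with hw'
      set p' : Fin (k + 2) → V := fun i => p i.succ with hp'
      have hp'inj : Function.Injective p' := fun i j h => Fin.succ_injective _ (hpinj h)
      have hp'A : ∀ i, p' i ∉ A := fun i => hpA i.succ
      have hchain' : ∀ (i : Fin (k + 2)) (u : V), i.val ≤ k → u ∉ A → u ≠ p' i → w' s(p' i, u) ≠ 0 →
          ∃ l : Fin (k + 2), u = p' l ∧ (l.val = i.val + 1 ∨ i.val = l.val + 1) := by
        intro i u hik huA hui hw
        have hu0 : u ≠ p 0 := by
          rintro rfl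
          exact hw (restrW_apply_of_not_mem w fun h => (mk_mem_wireSet_iff.1 h).2.1 rfl)
        have hw0 : w s(p i.succ, u) ≠ 0 := fun h0 =>
          hw (le_antisymm ((restrW_le _ w _).trans h0.le) bot_le)
        have hik' : (i.succ).val ≤ k + 1 := by rw [Fin.val_succ]; omega
        obtain ⟨l, rfl, hl⟩ := hchain i.succ u hik' huA hui hw0
        have hl0 : l ≠ 0 := fun h => hu0 (by rw [h])
        have hlv : l.val ≠ 0 := fun h => hl0 (Fin.ext h)
        refine ⟨l.pred hl0, by simp [hp'], ?_⟩
        have hsucc : (i.succ).val = i.val + 1 := Fin.val_succ i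
        rcases hl with hl | hl
        · left; rw [Fin.val_pred]; omega
        · right; rw [Fin.val_pred]; omega
      have htip' : KNGood (restrW ({v | ∃ i : Fin (k + 2), i.val ≤ k ∧ v = p' i}ᶜ : Set V) w') A hA
          (p' (Fin.last (k + 1))) b := by
        rw [hw', restrW_restrW]
        have hset : ({v | ∃ i : Fin (k + 2), i.val ≤ k ∧ v = p' i}ᶜ ∩ ({p 0}ᶜ : Set V)) =
            ({v | ∃ i : Fin (k + 1 + 2), i.val ≤ k + 1 ∧ v = p i}ᶜ : Set V) := by
          rw [← compl_union]
          congr 1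
          ext v
          simp only [mem_union, mem_setOf_eq, mem_singleton_iff, hp']
          constructor
          · rintro (⟨i, hi, rfl⟩ | rfl)
            · exact ⟨i.succ, by rw [Fin.val_succ]; omega, rfl⟩
            · exact ⟨0, Nat.zero_le _, rfl⟩
          · rintro ⟨i, hi, rfl⟩
            by_cases hi0 : i = 0
            · right; rw [hi0]
            · left
              refine ⟨i.pred hi0, ?_, by simp⟩
              have hiv : i.val ≠ 0 := fun h => hi0 (Fin.ext h)
              rw [Fin.val_pred]; omega
        have hlast : p' (Fin.last (k + 1)) = p (Fin.last (k + 1 + 1)) := by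
          simp only [hp']
          congr 1
        rw [hset, hlast]
        exact htip
      have := ih w' p' hp'inj hp'A hchain' htip'
      simpa [hp'] using this

end SpiderGluing

end

end Summit.CriticalPhenomena.PercolationContinuityZ3.Theorems
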